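import Literature.IUT.HodgeTheaters.PMBaseKit
import Literature.IUT.HodgeTheaters.Labels
import HarnessLib

/-!
# The `C_K`-side NF kit `NFKit` over abc-iut-L5-t4's base kit ([IUTchI] Def 4.1 (v)(vi), Ex 4.3, Ex 4.5 (i)(ii),
# Def 6.1 (v)) and its derived `φ^NF`-block — post-freeze additive D13 (converse dictionary C9-h⁻¹, part 1; v2),
# not a cone member, not citable at 11:30Z

S. Mochizuki, *Inter-universal Teichmüller theory I*, kurims manuscript (May 2020): Definition 4.1 (v) p. 97 ("the set of
label classes of cusps `LabCusp(†𝒟^⊚)` of `†𝒟^⊚`, which admits a natural `𝔽_l^⋇`-torsor structure"; `𝕍(†𝒟^⊚)`), (vi)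
p. 97 ("we define a poly-morphism `†𝒟_v → †𝒟^⊚` to be a collection of morphisms `†𝒟_v → †𝒟^⊚`"), Example 4.3 (i)–(iii)
pp. 98–100 (`Aut_ε(C_K) ⊆ Aut(C_K) ≅ Aut(𝒟^⊚)`, "natural isomorphisms … `Aut(C_K)/Aut_ε(C_K) ⥲ 𝔽_l^⋇`", the natural morphism
`φ^NF_{•,v} : 𝒟_v → 𝒟^⊚` and the poly-morphisms "`β ∘ φ^NF_{•,v} ∘ α`"), Example 4.5 (i), (ii) pp. 107–108 (the natural
isomorphism of `𝔽_l^⋇`-torsors `LabCusp(𝒟^⊚) ⥲ LabCusp(𝒟_{v})` induced by a `φ^NF`-type morphism; `[ε] ↦ η_v`), Definition 6.1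
(v) p. 158 ("a finite étale double covering `𝒟^{⊚±} → 𝒟^⊚ = ℬ(C_K)⁰`"; "natural surjective homomorphism `Aut(𝒟^{⊚±}) ↠ 𝔽_l^⋇`")
([IUTchI] Def 4.1 (v) p.97) [claim: Mochizuki2012, status: disputed] (D-0012 claim key, series status DISPUTED; a HYPOTHESIS
STRUCTURE + definitions; nothing of the series is asserted, no side is taken on [IUTchIII] Cor. 3.12).

## Why this file exists (L5-lead RULINGS #31 (1): NF-side kit «NFK», single writer abc-iut-L5-t3; design notes
HOME/staging/L5/L5-t3/DESIGN-BaseThetaDatum-ofKit.md, SHAPES-NFKit.md)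

abc-iut-L5-t4's base kit `PMBaseKit l` (Def 6.1) carries the `X_K`-side global objects only (`Glob`, `gModel = 𝒟^{⊚±}`,
`atV`, `phiEll = φ^{Θell}_{•,v}`, `GLab = LabCusp^±`, `toFlStar`); abc-iut-L5-t3's §4 datum `BaseThetaDatum` and
abc-iut-L5-t5's ΘNF-side kit (`S5Local.CatAmb`, `nfAtV`) need the `C_K`-side: isomorphs of `𝒟^⊚ = ℬ(C_K)⁰`, the
double covering `𝒟^{⊚±} → 𝒟^⊚` of Def 6.1 (v), `𝕍(†𝒟^⊚)`, the `𝔽_l^⋇`-torsors `LabCusp(†𝒟^⊚)` with `[ε]`, the morphisms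
`†𝒟_v → †𝒟^⊚` "seen at `v`" and the label pull-back of Ex 4.5 (i).  This file supplies that interface ONCE, as the
hypothesis structure `PMBaseKit.NFKit K` (one field per printed object; the two cross-side junctions — Def 6.1 (v)'s
MODEL double covering seen at `v`, `projAt`, and the `φ^NF_{•,v} = (𝒟_v → 𝒟^{⊚±} → 𝒟^⊚)` factorisation `phiNF_eq` — are
FIELDS, instantiated at D13 by abc-iut-L5-t4's `globCover = OrbitCat.homOfElem 1` and abc-iut-L5-t3's `phiNFAt_eq`;
v2: v1's functor `proj` + natural `atVProj` were NOT instantiable there, see `projAt`), and DERIVES from it abc-iut-L5-t3's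
§4 `φ^NF`-block: the type `NFKit.HomNF x X Y` of `φ^NF`-type morphisms := the SUBTYPE of kit morphisms
`X ⟶ nfAtV x Y` abstractly equivalent to `φ^NF_{•,v}` (so that pre- and post-composition and "every such morphism is a
conjugate of `φ^NF_{•,v}`" — `BaseThetaDatum.exists_eq_phiNF` — are DEFINITIONAL), with the laws
`preNF_refl/_trans`, `postNF_refl/_trans`, `preNF_postNF`, `exists_eq_phiNF` PROVED, and `labPull` with its four laws
read off the kit's fields.  Part 2 (`BaseThetaDatum.ofKitCore`, `KitCore.ofKit`, `NFLink.ofKit`) assembles these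
with the local blocks.  KIT-RULE: an inhabitant over abc-iut-L5-t4's toy kit is given in `KitNFSideNonVacuityWitness.lean` (degenerate).
-/

namespace Literature.IUT.HodgeTheaters

open CategoryTheory

universe u

namespace PMBaseKit

variable {l : ℕ} (K : PMBaseKit.{u} l)

/-- Def 4.1 (i): the isomorphs `†𝒟_v` of the model `𝒟_v` inside the kit's ambient category at `v` — the full
subcategory of abc-iut-L5-t4's `IsLocal` objects (abc-iut-L5-t3's `BaseThetaDatum.Amb v` at the D13 instance).
([IUTchI] Def 4.1 (i) p.95) [claim: Mochizuki2012, status: disputed] -/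
abbrev LocalObj (x : K.V) : Type u := ObjectProperty.FullSubcategory (K.IsLocal x)

/-- The model `𝒟_v` as a local object. ([IUTchI] Def 4.1 (i) p.95) [claim: Mochizuki2012, status: disputed] -/
abbrev localModel (x : K.V) : K.LocalObj x := ⟨K.model x, K.isLocal_model x⟩

/-- **`NFKit(K)` — the `C_K`-side NF kit over a base kit** (HYPOTHESIS STRUCTURE; one field per printed object of
[IUTchI] Def 4.1 (v)(vi), Ex 4.3 (i)–(iii), Ex 4.5 (i)(ii), Def 6.1 (v); no field asserts a result of the series).
([IUTchI] Def 4.1 (v) p.97) [claim: Mochizuki2012, status: disputed] -/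
structure NFKit where
  /-- Def 4.1 (v): the category of isomorphs `†𝒟^⊚` of `𝒟^⊚ := ℬ(C_K)⁰` ("categories equivalent to `𝒟^⊚`") and their
  isomorphisms (§0) -/
  GlobNF : Type u
  /-- category structure -/
  [catGlobNF : Category.{u} GlobNF]
  /-- the model `𝒟^⊚ = ℬ(C_K)⁰` -/
  gnfModel : GlobNF
  /-- every object is an isomorph of `𝒟^⊚` -/
  gnf_iso : ∀ X Y : GlobNF, Nonempty (X ≅ Y)
  /-- Def 4.1 (vi) / Ex 4.3 (ii): an isomorph `†𝒟^⊚` "seen at `v`" — an object of the kit's ambient category at `v`, so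
  that the morphisms `†𝒟_v → †𝒟^⊚` of Def 4.1 (vi) are morphisms of `Amb v` (abc-iut-L5-t5's `S5Local.nfAtV`), functorially -/
  nfAtV : ∀ x : K.V, GlobNF ⥤ K.Amb x
  /-- Def 6.1 (v): "a finite étale double covering `𝒟^{⊚±} → 𝒟^⊚ = ℬ(C_K)⁰`" — the MODEL covering, seen at `v` (at the
  D13 instance: abc-iut-L5-t4's `globCover = OrbitCat.homOfElem 1` for `Π_{X̲_K} ≤ Π_{C̲_K}`).  Deliberately NOT a functor
  on isomorphs: `Gal(X̲_K/C_K) ≅ 𝔽_l ⋊ {±1}` (Def 6.1 (v)) is dihedral and its reflections are not normal, so inside the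
  ambient the passage `†𝒟^{⊚±} ↦ †𝒟^⊚` is not functorial in the morphisms of `†𝒟^{⊚±}` (v1's `proj`/`atVProj` were
  uninstantiable at D13 and are withdrawn) … -/
  projAt : ∀ x : K.V, (K.atV x).obj K.gModel ⟶ (nfAtV x).obj gnfModel
  /-- Ex 4.3 (ii), (iii): the natural morphism `φ^NF_{•,v} : 𝒟_v → 𝒟^⊚` (from `X→_v → C_v → C_K`, resp.
  `X̲_v → C_v → C_K`, resp. the tautological arrow at `v ∈ 𝕍^arc`) … -/
  phiNF : ∀ x : K.V, K.model x ⟶ (nfAtV x).obj gnfModel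
  /-- … which FACTORS as `𝒟_v → 𝒟^{⊚±} → 𝒟^⊚` (`X→_v → X_K → C_K`; Def 6.1 (v) / Ex 6.3 (i)): `φ^NF_{•,v}` is the kit's
  `φ^{Θell}_{•,v}` followed by the double covering seen at `v` (at D13: abc-iut-L5-t3's `InitialThetaData.phiNFAt_eq`). -/
  phiNF_eq : ∀ x : K.V, phiNF x = K.phiEll x ≫ projAt x
  /-- Def 4.1 (v): "`𝕍̲(†𝒟^⊚) := 𝕍(†𝒟^⊚)/π₁(†𝒟^⊚)`" ([AbsTopIII] Thm 1.9), reconstructed from `†𝒟^⊚` … -/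
  Val : GlobNF → Type
  /-- … transported along isomorphisms … -/
  valIso : ∀ {X Y : GlobNF}, (X ≅ Y) → Val X ≃ Val Y
  /-- … functorially: identities … -/
  valIso_refl : ∀ X : GlobNF, valIso (Iso.refl X) = Equiv.refl _
  /-- … and composites. -/
  valIso_trans : ∀ {X Y Z : GlobNF} (f : X ≅ Y) (g : Y ≅ Z), valIso (f ≪≫ g) = (valIso f).trans (valIso g)
  /-- Def 3.1 (e): the kit's places are valuations of `V(𝒟^⊚) = 𝕍(K)` ("i.e. `V(K)`", Def 4.1 (v) l. 13–18): `𝕍̲ ⊆ 𝕍(K)`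
  read on the kit's index set — a MAP into `Val (𝒟^⊚)`, never an equivalence (abc-iut-L5-t2: at the D13 instance
  `Val 𝒟^⊚ = Val K`, all places of `K`, and `valOfV = Subtype.val ∘ T.e` for abc-iut-L5-t4's place kit `T`) -/
  valOfV : K.V ↪ Val gnfModel
  /-- Def 4.1 (v): "the set of label classes of cusps `LabCusp(†𝒟^⊚)`" … -/
  GLabNF : GlobNF → Type
  /-- … "which admits a natural `𝔽_l^⋇`-torsor structure" … -/
  [actGLabNF : ∀ Y : GlobNF, MulAction (FlStar l) (GLabNF Y)]
  /-- … simply transitive … -/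
  isTorsor_gLabNF : ∀ Y : GlobNF, IsTorsor (FlStar l) (GLabNF Y)
  /-- … transported by isomorphisms ([AbsTopI] Lem 4.5 is category-theoretic) … -/
  gLabNFMap : ∀ {X Y : GlobNF}, (X ≅ Y) → GLabNF X ≃ GLabNF Y
  /-- … equivariantly … -/
  gLabNFMap_smul : ∀ {X Y : GlobNF} (b : X ≅ Y) (j : FlStar l) (c : GLabNF X), gLabNFMap b (j • c) = j • gLabNFMap b c
  /-- … functorially: identities … -/
  gLabNFMap_refl : ∀ Y : GlobNF, gLabNFMap (Iso.refl Y) = Equiv.refl _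
  /-- … and composites. -/
  gLabNFMap_trans : ∀ {X Y Z : GlobNF} (b : X ≅ Y) (b' : Y ≅ Z),
    gLabNFMap (b ≪≫ b') = (gLabNFMap b).trans (gLabNFMap b')
  /-- Ex 4.5 (ii) / Def 3.1 (f): the class `[ε] ∈ LabCusp(𝒟^⊚)` of the chosen cusp `ε` of `C_K` -/
  εLab : GLabNF gnfModel
  /-- Ex 4.3 (i): "`Aut(C_K)/Aut_ε(C_K) ⥲ 𝔽_l^⋇`" — every label translation of `LabCusp(𝒟^⊚)` is effected by an
  automorphism of `𝒟^⊚` (at the D13 instance: the kit's `toFlStar` is surjective and `Aut(𝒟^{⊚±})` descends through the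
  double covering) -/
  exists_aut_smul : ∀ j : FlStar l, ∃ b : gnfModel ≅ gnfModel, ∀ c : GLabNF gnfModel, gLabNFMap b c = j • c
  /-- Ex 4.5 (i): the `𝔽_l^⋇`-torsor `LabCusp(†𝒟_v)` of Def 4.1 (ii) on the kit side — "`{LabCusp^±(†𝒟_v) ∖ {†η⁰_v}}/{±1}
  ⥲ LabCusp(†𝒟_v)`" (Def 6.1 (iii) p. 156): supplied by the kit's `±`-label structure through abc-iut-L5-t3's
  `KitCoreLabCusp` at the instance; here an abstract `𝔽_l^⋇`-torsor per object with its canonical element … -/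
  LabStar : ∀ x : K.V, K.LocalObj x → Type
  /-- … `𝔽_l^⋇`-action … -/
  [actLabStar : ∀ x (X : K.LocalObj x), MulAction (FlStar l) (LabStar x X)]
  /-- … simply transitive … -/
  isTorsor_labStar : ∀ x (X : K.LocalObj x), IsTorsor (FlStar l) (LabStar x X)
  /-- … functorial in isomorphisms of `Amb v` … -/
  labStarIso : ∀ {x} {X Y : K.LocalObj x}, (X ≅ Y) → LabStar x X ≃ LabStar x Y
  /-- … equivariantly … -/
  labStarIso_smul : ∀ {x} {X Y : K.LocalObj x} (f : X ≅ Y) (j : FlStar l) (c : LabStar x X),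
    labStarIso f (j • c) = j • labStarIso f c
  /-- … identities … -/
  labStarIso_refl : ∀ {x} (X : K.LocalObj x), labStarIso (Iso.refl X) = Equiv.refl _
  /-- … composites … -/
  labStarIso_trans : ∀ {x} {X Y Z : K.LocalObj x} (f : X ≅ Y) (g : Y ≅ Z),
    labStarIso (f ≪≫ g) = (labStarIso f).trans (labStarIso g)
  /-- … with the canonical element `†η_v` (Def 4.1 (ii); Def 6.1 (iii): the image of `†η^±_v`) … -/
  ηStar : ∀ x (X : K.LocalObj x), LabStar x X
  /-- … preserved by every isomorphism. -/
  labStarIso_η : ∀ {x} {X Y : K.LocalObj x} (f : X ≅ Y), labStarIso f (ηStar x X) = ηStar x Y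
  /-- Ex 4.5 (i): a `φ^NF`-type morphism `†𝒟_v → †𝒟^⊚` induces "a natural isomorphism of `𝔽_l^⋇`-torsors
  `LabCusp(†𝒟^⊚) ⥲ LabCusp(†𝒟_v)`" (cuspidal inertia groups; Cor 2.5 at bad `v`, closures at `v ∈ 𝕍^arc`) — here for
  every kit morphism `X ⟶ nfAtV v Y` from a LOCAL object (the `φ^NF`-type ones are singled out below) … -/
  labPull : ∀ {x} {X : K.LocalObj x} {Y : GlobNF}, (X.obj ⟶ (nfAtV x).obj Y) → (GLabNF Y ≃ LabStar x X)
  /-- … equivariantly … -/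
  labPull_smul : ∀ {x} {X : K.LocalObj x} {Y : GlobNF} (f : X.obj ⟶ (nfAtV x).obj Y) (j : FlStar l) (c : GLabNF Y),
    labPull f (j • c) = j • labPull f c
  /-- … naturally in isomorphisms of the source … -/
  labPull_pre : ∀ {x} {X X' : K.LocalObj x} {Y : GlobNF} (a : X' ≅ X) (f : X.obj ⟶ (nfAtV x).obj Y) (c : GLabNF Y),
    labPull (a.hom.hom ≫ f) c = (labStarIso a).symm (labPull f c)
  /-- … and of the target … -/
  labPull_post : ∀ {x} {X : K.LocalObj x} {Y Y' : GlobNF} (f : X.obj ⟶ (nfAtV x).obj Y) (b : Y ≅ Y') (c : GLabNF Y'),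
    labPull (f ≫ (nfAtV x).map b.hom) c = labPull f ((gLabNFMap b).symm c)
  /-- Ex 4.5 (ii): along `φ^NF_{•,v}` itself the class `[ε]` pulls back to the canonical element `η_v`
  (Def 3.1 (f): "`ε_v` is the cusp of `C_v` determined by `ε`"). -/
  labPull_phiNF_εLab : ∀ x : K.V, labPull (X := K.localModel x) (phiNF x) εLab = ηStar x (K.localModel x)

namespace NFKit

variable {K} (N : K.NFKit)

/-- The category structure on the isomorphs of `𝒟^⊚` carried by the kit. ([IUTchI] Def 4.1 (v) p.97) [claim: Mochizuki2012, status: disputed] -/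
instance instCategoryGlobNF : Category.{u} N.GlobNF := N.catGlobNF

/-- The `𝔽_l^⋆`-action on `LabCusp(†𝒟^⊚)` carried by the kit. ([IUTchI] Def 4.1 (v) p.97) [claim: Mochizuki2012, status: disputed] -/
instance instMulActionGLabNF (Y : N.GlobNF) : MulAction (FlStar l) (N.GLabNF Y) := N.actGLabNF Y

/-- The `𝔽_l^⋆`-action on `LabCusp(†𝒟_v)` carried by the kit. ([IUTchI] Def 4.1 (ii) p.96) [claim: Mochizuki2012, status: disputed] -/
instance instMulActionLabStar {x : K.V} (X : K.LocalObj x) : MulAction (FlStar l) (N.LabStar x X) := N.actLabStar x X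

/-! ### The `φ^NF`-block of abc-iut-L5-t3's §4 datum, READ OFF the kit -/

/-- **Def 4.1 (vi) / Ex 4.3 (ii)(iii): the `φ^NF`-type morphisms `X → †𝒟^⊚`** ("morphisms abstractly equivalent [§0]
to the natural morphism `φ^NF_{•,v} : 𝒟_v → 𝒟^⊚`": the conjugates `b ∘ φ^NF_{•,v} ∘ a` by isomorphisms) — the SUBTYPE of
kit morphisms `X ⟶ nfAtV v Y` of that shape; this is abc-iut-L5-t3's abstract `BaseThetaDatum.HomNF v X Y`, made
concrete so that `exists_eq_phiNF` is definitional. ([IUTchI] Ex 4.3 (ii) p.99) [claim: Mochizuki2012, status: disputed] -/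
def HomNF (x : K.V) (X : K.LocalObj x) (Y : N.GlobNF) : Type u :=
  {f : X.obj ⟶ (N.nfAtV x).obj Y //
    ∃ (a : X.obj ≅ K.model x) (b : N.gnfModel ≅ Y), f = a.hom ≫ N.phiNF x ≫ (N.nfAtV x).map b.hom}

/-- `φ^NF_{•,v}` itself as a `φ^NF`-type morphism. ([IUTchI] Ex 4.3 (ii) p.99) [claim: Mochizuki2012, status: disputed] -/
def phiNF' (x : K.V) : N.HomNF x (K.localModel x) N.gnfModel :=
  ⟨N.phiNF x, Iso.refl _, Iso.refl _, by simp⟩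

/-- "Pre-composite … with a morphism" (Def 4.1 (v)(vi)): pre-composition of a `φ^NF`-type morphism with an
isomorphism `X' ⥲ X`. ([IUTchI] Def 4.1 (vi) p.97) [claim: Mochizuki2012, status: disputed] -/
def preNF {x : K.V} {X X' : K.LocalObj x} {Y : N.GlobNF} (a : X' ≅ X) (f : N.HomNF x X Y) : N.HomNF x X' Y :=
  ⟨a.hom.hom ≫ f.1, by
    obtain ⟨a₀, b₀, h⟩ := f.2
    exact ⟨(ObjectProperty.ι _).mapIso a ≪≫ a₀, b₀, by rw [h]; simp⟩⟩

/-- "Post-composite … with an isomorphism `†𝒟^⊚ ⥲ ‡𝒟^⊚`" (Def 4.1 (v)(vi)). ([IUTchI] Def 4.1 (vi) p.97) [claim: Mochizuki2012, status: disputed] -/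
def postNF {x : K.V} {X : K.LocalObj x} {Y Y' : N.GlobNF} (f : N.HomNF x X Y) (b : Y ≅ Y') : N.HomNF x X Y' :=
  ⟨f.1 ≫ (N.nfAtV x).map b.hom, by
    obtain ⟨a₀, b₀, h⟩ := f.2
    exact ⟨a₀, b₀ ≪≫ b, by rw [h]; simp⟩⟩

/-- The underlying kit morphism of a pre-composite. ([IUTchI] Def 4.1 (vi) p.97) [claim: Mochizuki2012, status: disputed] -/
@[simp] theorem preNF_val {x : K.V} {X X' : K.LocalObj x} {Y : N.GlobNF} (a : X' ≅ X) (f : N.HomNF x X Y) :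
    (N.preNF a f).1 = a.hom.hom ≫ f.1 := rfl

/-- The underlying kit morphism of a post-composite. ([IUTchI] Def 4.1 (vi) p.97) [claim: Mochizuki2012, status: disputed] -/
@[simp] theorem postNF_val {x : K.V} {X : K.LocalObj x} {Y Y' : N.GlobNF} (f : N.HomNF x X Y) (b : Y ≅ Y') :
    (N.postNF f b).1 = f.1 ≫ (N.nfAtV x).map b.hom := rfl

/-- `φ^NF`-type morphisms are determined by their underlying kit morphism. ([IUTchI] Def 4.1 (vi) p.97) [claim: Mochizuki2012, status: disputed] -/
theorem HomNF.ext' {x : K.V} {X : K.LocalObj x} {Y : N.GlobNF} {f g : N.HomNF x X Y} (h : f.1 = g.1) : f = g :=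
  Subtype.ext h

/-- `preNF (Iso.refl _) f = f` (abc-iut-L5-t3's `preNF_refl`, definitional here). ([IUTchI] Def 4.1 (vi) p.97) [claim: Mochizuki2012, status: disputed] -/
theorem preNF_refl {x : K.V} {X : K.LocalObj x} {Y : N.GlobNF} (f : N.HomNF x X Y) : N.preNF (Iso.refl X) f = f :=
  HomNF.ext' N (by simp)

/-- `preNF (a' ≪≫ a) f = preNF a' (preNF a f)`. ([IUTchI] Def 4.1 (vi) p.97) [claim: Mochizuki2012, status: disputed] -/
theorem preNF_trans {x : K.V} {X X' X'' : K.LocalObj x} {Y : N.GlobNF} (a' : X'' ≅ X') (a : X' ≅ X) (f : N.HomNF x X Y) :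
    N.preNF (a' ≪≫ a) f = N.preNF a' (N.preNF a f) :=
  HomNF.ext' N (by simp)

/-- `postNF f (Iso.refl _) = f`. ([IUTchI] Def 4.1 (vi) p.97) [claim: Mochizuki2012, status: disputed] -/
theorem postNF_refl {x : K.V} {X : K.LocalObj x} {Y : N.GlobNF} (f : N.HomNF x X Y) : N.postNF f (Iso.refl Y) = f :=
  HomNF.ext' N (by simp)

/-- `postNF f (b ≪≫ b') = postNF (postNF f b) b'`. ([IUTchI] Def 4.1 (vi) p.97) [claim: Mochizuki2012, status: disputed] -/
theorem postNF_trans {x : K.V} {X : K.LocalObj x} {Y Y' Y'' : N.GlobNF} (f : N.HomNF x X Y) (b : Y ≅ Y') (b' : Y' ≅ Y'') :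
    N.postNF f (b ≪≫ b') = N.postNF (N.postNF f b) b' :=
  HomNF.ext' N (by simp)

/-- Pre- and post-composition commute. ([IUTchI] Def 4.1 (vi) p.97) [claim: Mochizuki2012, status: disputed] -/
theorem preNF_postNF {x : K.V} {X X' : K.LocalObj x} {Y Y' : N.GlobNF} (a : X' ≅ X) (f : N.HomNF x X Y) (b : Y ≅ Y') :
    N.preNF a (N.postNF f b) = N.postNF (N.preNF a f) b :=
  HomNF.ext' N (by simp)

/-- **Every `φ^NF`-type morphism is a conjugate of `φ^NF_{•,v}`** (abc-iut-L5-t3's axiom `exists_eq_phiNF` — here by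
construction of the subtype). ([IUTchI] Ex 4.3 (ii) p.99) [claim: Mochizuki2012, status: disputed] -/
theorem exists_eq_phiNF {x : K.V} {X : K.LocalObj x} {Y : N.GlobNF} (f : N.HomNF x X Y) :
    ∃ (a : X ≅ K.localModel x) (b : N.gnfModel ≅ Y), f = N.postNF (N.preNF a (N.phiNF' x)) b := by
  obtain ⟨a, b, h⟩ := f.2
  exact ⟨(ObjectProperty.fullyFaithfulι _).preimageIso a, b, HomNF.ext' N (by simp [phiNF', h])⟩

/-! ### The label pull-back of Ex 4.5 (i) along `φ^NF`-type morphisms -/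

/-- Ex 4.5 (i) for `φ^NF`-type morphisms: the induced isomorphism of `𝔽_l^⋇`-torsors `LabCusp(†𝒟^⊚) ⥲ LabCusp(†𝒟_v)`.
([IUTchI] Ex 4.5 (i) p.107) [claim: Mochizuki2012, status: disputed] -/
def labPullNF {x : K.V} {X : K.LocalObj x} {Y : N.GlobNF} (f : N.HomNF x X Y) : N.GLabNF Y ≃ N.LabStar x X :=
  N.labPull f.1

/-- Equivariance of the label pull-back. ([IUTchI] Ex 4.5 (i) p.107) [claim: Mochizuki2012, status: disputed] -/
theorem labPullNF_smul {x : K.V} {X : K.LocalObj x} {Y : N.GlobNF} (f : N.HomNF x X Y) (j : FlStar l) (c : N.GLabNF Y) :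
    N.labPullNF f (j • c) = j • N.labPullNF f c :=
  N.labPull_smul f.1 j c

/-- Naturality of the label pull-back in isomorphisms of the source. ([IUTchI] Ex 4.5 (i) p.107) [claim: Mochizuki2012, status: disputed] -/
theorem labPullNF_preNF {x : K.V} {X X' : K.LocalObj x} {Y : N.GlobNF} (a : X' ≅ X) (f : N.HomNF x X Y) (c : N.GLabNF Y) :
    N.labPullNF (N.preNF a f) c = (N.labStarIso a).symm (N.labPullNF f c) :=
  N.labPull_pre a f.1 c

/-- Naturality of the label pull-back in isomorphisms of the target. ([IUTchI] Ex 4.5 (i) p.107) [claim: Mochizuki2012, status: disputed] -/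
theorem labPullNF_postNF {x : K.V} {X : K.LocalObj x} {Y Y' : N.GlobNF} (f : N.HomNF x X Y) (b : Y ≅ Y') (c : N.GLabNF Y') :
    N.labPullNF (N.postNF f b) c = N.labPullNF f ((N.gLabNFMap b).symm c) :=
  N.labPull_post f.1 b c

/-- Ex 4.5 (ii): `[ε] ↦ η_v` along `φ^NF_{•,v}`. ([IUTchI] Ex 4.5 (ii) p.108) [claim: Mochizuki2012, status: disputed] -/
theorem labPullNF_phiNF'_εLab (x : K.V) : N.labPullNF (N.phiNF' x) N.εLab = N.ηStar x (K.localModel x) :=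
  N.labPull_phiNF_εLab x

end NFKit

end PMBaseKit

end Literature.IUT.HodgeTheaters
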